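import Mathlib
import Literature.Analysis.FluidPDE.GaussianVortexPlanar
import Literature.Analysis.FluidPDE.GaussianVortexPlanarProofs
import Summits.AnomalousDissipation.AnomalousDissipation.Theorems.MarginalStabilityChainStretchedVortexRowsStubCoreInverseAngular
import Summits.AnomalousDissipation.AnomalousDissipation.Theorems.MarginalStabilityChainStretchedVortexRowsStubCoreRotationLocalSkew
import Summits.AnomalousDissipation.AnomalousDissipation.Theorems.MarginalStabilityChainStretchedVortexRowsStubCoreLAngularPairingTools
import HarnessLib

/-!
# Helper `coreL_angular_pairing_eq_zero` toward stub `stub_coreInverse` of the line `braid-closed-large-circulation-gluing`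
# (crux stmt-AnomalousDissipation-3009, `MarginalStabilityChain.StretchedVortexRows`)

(I9) of the energy method for the core inverse: the symmetric part `L` of the core operator and the angular derivative
`∂_θ` are orthogonal in `L²(G⁻¹)`, `⟨L w, ∂_θ w⟩_{L²(G⁻¹)} = 0`. In ground-state variables `w = G u`
(`G = gaussVortexProfile = (4π)⁻¹e^{−|ξ|²/4}`, `L(Gu) = G·Au` with the Ornstein–Uhlenbeck operator `Au = Δu − ½ ξ·∇u`,
tree `strainedVorticityOperator_weight_mul` at `λ = 0`) this is

  `∫ G (Δu − ½ ξ·∇u) · Du[ξ^⊥] dξ = 0`     for `u ∈ C²(ℝ²)` with `u, Du, D²u` bounded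

(`coreL_angular_pairing_eq_zero`). Proof (two derivatives of `u` only; pointwise calculus in `…StubCoreLAngularPairingTools`):
* divergence form `G·Au = ∂₀(G∂₀u) + ∂₁(G∂₁u)` (`coreL_gauss_divergence_form`);
* one integration by parts on the whole plane in each direction (Mathlib `integral_mul_fderiv_eq_neg_fderiv_mul_of_integrable`;
  no boundary terms: every product is `O((1+|ξ|)²G) ∈ L¹` by the Gaussian moments of `…StubCoreRotationLocalSkew`): `∫ G·Au·∂_θu = −∫ G ∇u·∇(∂_θu)`;
* `G ∇u·∇(∂_θu) = ½ ∂_θ(G|∇u|²)` pointwise (`fderiv_angularDeriv_mul_gaussFlux_sum_eq`: the commutator `[∇, ∂_θ]u` is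
  orthogonal to `∇u`, `D²u` is symmetric, `∂_θG = 0`);
* the angular derivative of a `C¹` function with one moment integrates to zero (landed `integral_fderiv_perp_eq_zero`).

References: Th. Gallay, C. E. Wayne, Comm. Math. Phys. 255 (2005) §4 (`L` commutes with rotations); T. Li, D. Wei, Z. Zhang,
arXiv:1701.06269, §2; D. Bakry, I. Gentil, M. Ledoux, Springer 2014, §2.7.1.
-/

set_option linter.dupNamespace false

noncomputable section

open scoped RealInnerProductSpace Topology Laplacian
open MeasureTheory WithLp Function Filter

namespace Summit.AnomalousDissipation.AnomalousDissipation.Theorems.MarginalStabilityChainStretchedVortexRows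

open Literature.Analysis.FluidPDE Literature.Analysis.UnboundedOperators

section CoreBound

variable {u : EuclideanSpace ℝ (Fin 2) → ℝ} (hu : ContDiff ℝ 2 u)
  {M : ℝ} (hM : ∀ ξ, |u ξ| ≤ M ∧ ‖fderiv ℝ u ξ‖ ≤ M ∧ ‖fderiv ℝ (fderiv ℝ u) ξ‖ ≤ M)
include hu hM

/-! ### Integrability of the products (no boundary terms at infinity) -/

/-- `∂_θu · ∂ᵢ(G∂ᵢu) ∈ L¹` (`O(|ξ|(1+|ξ|)G)`). [folklore] -/
theorem integrable_angularDeriv_mul_fderiv_gaussFlux (i : Fin 2) :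
    Integrable fun ξ : EuclideanSpace ℝ (Fin 2) => fderiv ℝ u ξ (perp ξ) *
      fderiv ℝ (fun y => gaussVortexProfile y * fderiv ℝ u y (EuclideanSpace.single i 1)) ξ
        (EuclideanSpace.single i 1) := by
  have hF : ContDiff ℝ 1 fun y => gaussVortexProfile y * fderiv ℝ u y (EuclideanSpace.single i 1) :=
    contDiff_gaussVortexProfile.mul (contDiff_one_partialDeriv hu _)
  refine integrable_of_le_one_add_norm_pow_mul_gauss
    ((contDiff_one_angularDeriv hu).continuous.mul ((hF.continuous_fderiv one_ne_zero).clm_apply continuous_const))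
    (A := M * M) (N := 2) fun z => ?_
  rw [norm_mul]
  have hM0 : 0 ≤ M := (norm_nonneg _).trans (hM z).2.1
  have hG := gaussVortexProfile_pos z
  calc ‖fderiv ℝ u z (perp z)‖ * ‖fderiv ℝ (fun y => gaussVortexProfile y *
          fderiv ℝ u y (EuclideanSpace.single i 1)) z (EuclideanSpace.single i 1)‖
      ≤ (M * ‖z‖) * (M * ((1 + ‖z‖) * gaussVortexProfile z)) :=
        mul_le_mul (norm_angularDeriv_le_of_coreBound hM z) (norm_fderiv_gaussFlux_le_of_coreBound hu hM z i) (norm_nonneg _)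
          (by positivity)
    _ ≤ (M * (1 + ‖z‖)) * (M * ((1 + ‖z‖) * gaussVortexProfile z)) := by
        gcongr
        linarith [norm_nonneg z]
    _ = M * M * ((1 + ‖z‖) ^ 2 * gaussVortexProfile z) := by ring

/-- `∂ᵢ(∂_θu) · (G∂ᵢu) ∈ L¹` (`O((1+|ξ|)G)`). [folklore] -/
theorem integrable_fderiv_angularDeriv_mul_gaussFlux (i : Fin 2) :
    Integrable fun ξ : EuclideanSpace ℝ (Fin 2) =>
      fderiv ℝ (fun y => fderiv ℝ u y (perp y)) ξ (EuclideanSpace.single i 1) *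
        (gaussVortexProfile ξ * fderiv ℝ u ξ (EuclideanSpace.single i 1)) := by
  refine integrable_of_le_one_add_norm_pow_mul_gauss
    ((((contDiff_one_angularDeriv hu).continuous_fderiv one_ne_zero).clm_apply continuous_const).mul
      ((contDiff_gaussVortexProfile (n := 0)).continuous.mul (contDiff_one_partialDeriv hu _).continuous))
    (A := M * M) (N := 1) fun z => ?_
  rw [norm_mul, norm_mul, Real.norm_of_nonneg (gaussVortexProfile_pos z).le, pow_one]
  have hM0 : 0 ≤ M := (norm_nonneg _).trans (hM z).2.1
  have hG := gaussVortexProfile_pos z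
  calc ‖fderiv ℝ (fun y => fderiv ℝ u y (perp y)) z (EuclideanSpace.single i 1)‖ *
        (gaussVortexProfile z * ‖fderiv ℝ u z (EuclideanSpace.single i 1)‖)
      ≤ (M * (1 + ‖z‖)) * (gaussVortexProfile z * M) := by
        gcongr
        · exact norm_fderiv_angularDeriv_single_le_of_coreBound hu hM z i
        · exact norm_partialDeriv_le_of_coreBound hM z i
    _ = M * M * ((1 + ‖z‖) * gaussVortexProfile z) := by ring

/-- `∂_θu · (G∂ᵢu) ∈ L¹` (`O(|ξ|G)`). [folklore] -/
theorem integrable_angularDeriv_mul_gaussFlux (i : Fin 2) :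
    Integrable fun ξ : EuclideanSpace ℝ (Fin 2) => fderiv ℝ u ξ (perp ξ) *
      (gaussVortexProfile ξ * fderiv ℝ u ξ (EuclideanSpace.single i 1)) := by
  refine integrable_of_le_one_add_norm_pow_mul_gauss
    ((contDiff_one_angularDeriv hu).continuous.mul
      ((contDiff_gaussVortexProfile (n := 0)).continuous.mul (contDiff_one_partialDeriv hu _).continuous))
    (A := M * M) (N := 1) fun z => ?_
  rw [norm_mul, norm_mul, Real.norm_of_nonneg (gaussVortexProfile_pos z).le, pow_one]
  have hM0 : 0 ≤ M := (norm_nonneg _).trans (hM z).2.1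
  have hG := gaussVortexProfile_pos z
  calc ‖fderiv ℝ u z (perp z)‖ * (gaussVortexProfile z * ‖fderiv ℝ u z (EuclideanSpace.single i 1)‖)
      ≤ (M * ‖z‖) * (gaussVortexProfile z * M) := by
        gcongr
        · exact norm_angularDeriv_le_of_coreBound hM z
        · exact norm_partialDeriv_le_of_coreBound hM z i
    _ ≤ (M * (1 + ‖z‖)) * (gaussVortexProfile z * M) := by
        gcongr
        linarith [norm_nonneg z]
    _ = M * M * ((1 + ‖z‖) * gaussVortexProfile z) := by ring

/-- **One integration by parts on the plane**: `∫ ∂_θu · ∂ᵢ(G∂ᵢu) = −∫ ∂ᵢ(∂_θu) · G∂ᵢu`. [folklore] -/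
theorem integral_angularDeriv_mul_fderiv_gaussFlux (i : Fin 2) :
    ∫ ξ : EuclideanSpace ℝ (Fin 2), fderiv ℝ u ξ (perp ξ) *
        fderiv ℝ (fun y => gaussVortexProfile y * fderiv ℝ u y (EuclideanSpace.single i 1)) ξ
          (EuclideanSpace.single i 1) =
      -∫ ξ : EuclideanSpace ℝ (Fin 2),
        fderiv ℝ (fun y => fderiv ℝ u y (perp y)) ξ (EuclideanSpace.single i 1) *
          (gaussVortexProfile ξ * fderiv ℝ u ξ (EuclideanSpace.single i 1)) :=
  integral_mul_fderiv_eq_neg_fderiv_mul_of_integrable (integrable_fderiv_angularDeriv_mul_gaussFlux hu hM i)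
    (integrable_angularDeriv_mul_fderiv_gaussFlux hu hM i) (integrable_angularDeriv_mul_gaussFlux hu hM i)
    (fun x _ => (contDiff_one_angularDeriv hu).differentiable one_ne_zero x)
    (fun x _ => (contDiff_gaussVortexProfile.mul (contDiff_one_partialDeriv hu _)).differentiable one_ne_zero x)

/-- **`∫ ∂_θ(G|∇u|²) = 0`**: the weighted energy density `h = G((∂₀u)² + (∂₁u)²)` is `C¹` with `|ξ| h`, `|ξ| ‖Dh‖ ∈ L¹`,
so its angular derivative integrates to zero (landed `integral_fderiv_perp_eq_zero`). [folklore] -/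
theorem integral_angularDeriv_gaussEnergy_eq_zero :
    ∫ ξ : EuclideanSpace ℝ (Fin 2), fderiv ℝ (fun y => gaussVortexProfile y *
        (fderiv ℝ u y (EuclideanSpace.single 0 1) ^ 2 + fderiv ℝ u y (EuclideanSpace.single 1 1) ^ 2)) ξ
        (perp ξ) = 0 := by
  have hM0 : 0 ≤ M := (norm_nonneg _).trans (hM 0).2.1
  have hhC : ContDiff ℝ 1 fun y => gaussVortexProfile y *
      (fderiv ℝ u y (EuclideanSpace.single 0 1) ^ 2 + fderiv ℝ u y (EuclideanSpace.single 1 1) ^ 2) :=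
    contDiff_gaussVortexProfile.mul (((contDiff_one_partialDeriv hu _).pow 2).add
      ((contDiff_one_partialDeriv hu _).pow 2))
  have hsq : ∀ (z : EuclideanSpace ℝ (Fin 2)) (i : Fin 2), fderiv ℝ u z (EuclideanSpace.single i 1) ^ 2 ≤ M ^ 2 := by
    intro z i
    have h := norm_partialDeriv_le_of_coreBound hM z i
    rw [Real.norm_eq_abs] at h
    calc fderiv ℝ u z (EuclideanSpace.single i 1) ^ 2 = |fderiv ℝ u z (EuclideanSpace.single i 1)| ^ 2 :=
          (sq_abs _).symm
      _ ≤ M ^ 2 := pow_le_pow_left₀ (abs_nonneg _) h 2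
  refine integral_fderiv_perp_eq_zero _ hhC ?_ ?_
  · refine integrable_of_le_one_add_norm_pow_mul_gauss (continuous_norm.mul hhC.continuous) (A := 2 * M ^ 2) (N := 1) fun z => ?_
    have hG := gaussVortexProfile_pos z
    rw [norm_mul, norm_norm, norm_mul, Real.norm_of_nonneg hG.le, Real.norm_of_nonneg (by positivity), pow_one]
    calc ‖z‖ * (gaussVortexProfile z *
          (fderiv ℝ u z (EuclideanSpace.single 0 1) ^ 2 + fderiv ℝ u z (EuclideanSpace.single 1 1) ^ 2))
        ≤ (1 + ‖z‖) * (gaussVortexProfile z * (M ^ 2 + M ^ 2)) :=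
          mul_le_mul (by linarith [norm_nonneg z]) (mul_le_mul_of_nonneg_left (add_le_add (hsq z 0) (hsq z 1)) hG.le)
            (by positivity) (by positivity)
      _ = 2 * M ^ 2 * ((1 + ‖z‖) * gaussVortexProfile z) := by ring
  · refine integrable_of_le_one_add_norm_pow_mul_gauss (continuous_norm.mul (hhC.continuous_fderiv one_ne_zero).norm)
      (A := 4 * M ^ 2) (N := 2) fun z => ?_
    have hG := gaussVortexProfile_pos z
    rw [norm_mul, norm_norm, norm_norm]
    have hD : ‖fderiv ℝ (fun y => gaussVortexProfile y *
        (fderiv ℝ u y (EuclideanSpace.single 0 1) ^ 2 + fderiv ℝ u y (EuclideanSpace.single 1 1) ^ 2)) z‖ ≤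
        4 * M ^ 2 * ((1 + ‖z‖) * gaussVortexProfile z) := by
      refine ContinuousLinearMap.opNorm_le_bound _ (by positivity) fun w => ?_
      rw [fderiv_gaussEnergy_apply hu, fderiv_gaussVortexProfile_apply]
      have hin : |⟪z, w⟫| ≤ ‖z‖ * ‖w‖ := abs_real_inner_le_norm z w
      have hd0 := norm_partialDeriv_le_of_coreBound hM z 0
      have hd1 := norm_partialDeriv_le_of_coreBound hM z 1
      have hs0 : ‖fderiv ℝ (fderiv ℝ u) z w (EuclideanSpace.single 0 1)‖ ≤ M * ‖w‖ := by
        simpa using norm_fderiv_fderiv_apply_le_of_coreBound hM z w (EuclideanSpace.single 0 1)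
      have hs1 : ‖fderiv ℝ (fderiv ℝ u) z w (EuclideanSpace.single 1 1)‖ ≤ M * ‖w‖ := by
        simpa using norm_fderiv_fderiv_apply_le_of_coreBound hM z w (EuclideanSpace.single 1 1)
      rw [Real.norm_eq_abs] at hd0 hd1 hs0 hs1
      calc _ ≤ ‖-(gaussVortexProfile z / 2) * ⟪z, w⟫ *
              (fderiv ℝ u z (EuclideanSpace.single 0 1) ^ 2 + fderiv ℝ u z (EuclideanSpace.single 1 1) ^ 2)‖ +
            ‖gaussVortexProfile z *
              (2 * fderiv ℝ u z (EuclideanSpace.single 0 1) *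
                  fderiv ℝ (fderiv ℝ u) z w (EuclideanSpace.single 0 1) +
                2 * fderiv ℝ u z (EuclideanSpace.single 1 1) *
                  fderiv ℝ (fderiv ℝ u) z w (EuclideanSpace.single 1 1))‖ := norm_add_le _ _
        _ ≤ gaussVortexProfile z / 2 * (‖z‖ * ‖w‖) * (M ^ 2 + M ^ 2) +
            gaussVortexProfile z * (2 * M * (M * ‖w‖) + 2 * M * (M * ‖w‖)) := by
          refine add_le_add ?_ ?_
          · have hq0 : 0 ≤ fderiv ℝ u z (EuclideanSpace.single 0 1) ^ 2 +
                fderiv ℝ u z (EuclideanSpace.single 1 1) ^ 2 := by positivity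
            rw [Real.norm_eq_abs, abs_mul, abs_mul, abs_neg, abs_of_pos (half_pos hG), abs_of_nonneg hq0]
            exact mul_le_mul (mul_le_mul_of_nonneg_left hin (half_pos hG).le) (add_le_add (hsq z 0) (hsq z 1))
              hq0 (by positivity)
          · rw [Real.norm_eq_abs, abs_mul, abs_of_pos hG]
            refine mul_le_mul_of_nonneg_left ?_ hG.le
            calc _ ≤ |2 * fderiv ℝ u z (EuclideanSpace.single 0 1) *
                    fderiv ℝ (fderiv ℝ u) z w (EuclideanSpace.single 0 1)| +
                  |2 * fderiv ℝ u z (EuclideanSpace.single 1 1) *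
                    fderiv ℝ (fderiv ℝ u) z w (EuclideanSpace.single 1 1)| := abs_add_le _ _
              _ ≤ 2 * M * (M * ‖w‖) + 2 * M * (M * ‖w‖) := by
                  rw [abs_mul, abs_mul, abs_mul, abs_mul, abs_two]
                  gcongr
        _ = 4 * M ^ 2 * ((1 + ‖z‖) * gaussVortexProfile z) * ‖w‖ -
            3 * M ^ 2 * gaussVortexProfile z * ‖z‖ * ‖w‖ := by ring
        _ ≤ 4 * M ^ 2 * ((1 + ‖z‖) * gaussVortexProfile z) * ‖w‖ := by
          have : 0 ≤ 3 * M ^ 2 * gaussVortexProfile z * ‖z‖ * ‖w‖ := by positivity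
          linarith
    calc ‖z‖ * ‖fderiv ℝ (fun y => gaussVortexProfile y *
          (fderiv ℝ u y (EuclideanSpace.single 0 1) ^ 2 + fderiv ℝ u y (EuclideanSpace.single 1 1) ^ 2)) z‖
        ≤ (1 + ‖z‖) * (4 * M ^ 2 * ((1 + ‖z‖) * gaussVortexProfile z)) := by
          gcongr
          linarith [norm_nonneg z]
      _ = 4 * M ^ 2 * ((1 + ‖z‖) ^ 2 * gaussVortexProfile z) := by ring

end CoreBound

/-! ### The pairing `⟨L w, ∂_θ w⟩ = 0` -/

/-- H3 (I9): `⟨L w, ∂_θ w⟩_{L²(G⁻¹)} = 0` in ground-state variables: `∫ G (Δu − ½ ξ·∇u) (Du[ξ^⊥]) = 0`. -/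
theorem coreL_angular_pairing_eq_zero :
    ∀ u : EuclideanSpace ℝ (Fin 2) → ℝ, ContDiff ℝ 2 u →
      (∃ M : ℝ, ∀ ξ, |u ξ| ≤ M ∧ ‖fderiv ℝ u ξ‖ ≤ M ∧ ‖fderiv ℝ (fderiv ℝ u) ξ‖ ≤ M) →
      ∫ ξ, gaussVortexProfile ξ *
          (Δ u ξ - (1 / 2 * ξ 0 * fderiv ℝ u ξ (EuclideanSpace.single 0 1) +
            1 / 2 * ξ 1 * fderiv ℝ u ξ (EuclideanSpace.single 1 1))) *
          fderiv ℝ u ξ (perp ξ) = 0 := by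
  intro u hu hM
  obtain ⟨M, hM⟩ := hM
  -- divergence form of the integrand
  have hpt : ∀ ξ : EuclideanSpace ℝ (Fin 2), gaussVortexProfile ξ *
      (Δ u ξ - (1 / 2 * ξ 0 * fderiv ℝ u ξ (EuclideanSpace.single 0 1) +
        1 / 2 * ξ 1 * fderiv ℝ u ξ (EuclideanSpace.single 1 1))) * fderiv ℝ u ξ (perp ξ) =
      fderiv ℝ u ξ (perp ξ) *
          fderiv ℝ (fun y => gaussVortexProfile y * fderiv ℝ u y (EuclideanSpace.single 0 1)) ξ
            (EuclideanSpace.single 0 1) +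
        fderiv ℝ u ξ (perp ξ) *
          fderiv ℝ (fun y => gaussVortexProfile y * fderiv ℝ u y (EuclideanSpace.single 1 1)) ξ
            (EuclideanSpace.single 1 1) := by
    intro ξ
    rw [coreL_gauss_divergence_form u hu ξ]
    ring
  simp_rw [hpt]
  -- integrate by parts in each direction
  rw [integral_add (integrable_angularDeriv_mul_fderiv_gaussFlux hu hM 0) (integrable_angularDeriv_mul_fderiv_gaussFlux hu hM 1),
    integral_angularDeriv_mul_fderiv_gaussFlux hu hM 0, integral_angularDeriv_mul_fderiv_gaussFlux hu hM 1, ← neg_add,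
    ← integral_add (integrable_fderiv_angularDeriv_mul_gaussFlux hu hM 0) (integrable_fderiv_angularDeriv_mul_gaussFlux hu hM 1)]
  -- the new integrand is `½ ∂_θ(G|∇u|²)`, whose integral vanishes
  simp_rw [fderiv_angularDeriv_mul_gaussFlux_sum_eq hu]
  rw [integral_const_mul, integral_angularDeriv_gaussEnergy_eq_zero hu hM, mul_zero, neg_zero]

end Summit.AnomalousDissipation.AnomalousDissipation.Theorems.MarginalStabilityChainStretchedVortexRows

end
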